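import Summits.BirchSwinnertonDyer.BirchSwinnertonDyer.Theses.TameQuarticManinParity
import Literature.NumberTheory.EllipticCurves.RealLatticePeriod
import Literature.NumberTheory.EllipticCurves.Uniformization
import Literature.NumberTheory.EllipticCurves.IsogenyDegreeOneProofs
import HarnessLib

/-!
# Route `TameQuarticManinParity`, LINE 25c (bsd-idea-3 g8), support I25 `VariableChangeOfRationalHomothety`
# (stmt-BirchSwinnertonDyer-22887) — PROVED BY NAME (planner's proof, landed by the prover seat)

Cell `pub/bsd-wall`, D-0145 line `route-BirchSwinnertonDyer-TeichmullerTwistDescent`, seat `bsd-line-ttd-p1` g10.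
The PROOF is planner bsd-idea-3 g8's (`ideas/l25/I25_byname.lean`, 17:19Z), re-checked against the tree and wrapped in
the Theorems conventions; provers are the only writers under `Theorems/` (D-0016). BSD is NOT proved by this; Manin's
conjecture is not proved by this. Pure Weierstrass/PeriodPair statement: for elliptic `T, A / ℚ` with Néron-type period
pairs `Λ_T, Λ_A` and a rational `μ ≠ 0` with `z ∈ Λ_A ↔ μ z ∈ Λ_T`, there is `v : VariableChange ℚ` with `v • T = A`.
Proof: `g₂, g₃` of homothetic lattices (`PeriodPair.g₂_eq_of_lattice_eq`, `g₂_mulLeft`) give `c₄(A) = μ⁴ c₄(T)`,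
`c₆(A) = μ⁶ c₆(T)`; the short models (`Isogeny.shortChange_a₁_a₂_a₃`) are then related by the rescaling `⟨μ⁻¹, 0, 0, 0⟩`.
Design: theorems only; no definition, no named fact, no `sorry`; axioms `propext`, `Classical.choice`, `Quot.sound`.
-/

set_option autoImplicit false
-- D-0017: single-problem summit, so `Summit.BirchSwinnertonDyer.BirchSwinnertonDyer.…` repeats a namespace BY DESIGN.
set_option linter.dupNamespace false

noncomputable section

namespace Summit.BirchSwinnertonDyer.BirchSwinnertonDyer.Theorems.TameQuarticManinParity

open Literature.NumberTheory.EllipticCurves.ModularForms WeierstrassCurve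
  Summit.BirchSwinnertonDyer.BirchSwinnertonDyer.Theses.TameQuarticManinParity

/-- **`(c₄, c₆)` of two short models related by `(μ⁴, μ⁶)` ⇒ the rescaling `⟨μ⁻¹, 0, 0, 0⟩` maps one to the other**
(planner bsd-idea-3 g8's lemma, Sketch `I25_byname.lean`, re-checked). [cite: SilvermanAEC2009, III.1 Table 3.1] -/
theorem smul_eq_of_isShort_of_c₄_c₆ (E E' : WeierstrassCurve ℚ) (h₁ : E.a₁ = 0) (h₂ : E.a₂ = 0) (h₃ : E.a₃ = 0)
    (h₁' : E'.a₁ = 0) (h₂' : E'.a₂ = 0) (h₃' : E'.a₃ = 0) (μ : ℚ) (hμ : μ ≠ 0)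
    (hc₄ : E'.c₄ = μ ^ 4 * E.c₄) (hc₆ : E'.c₆ = μ ^ 6 * E.c₆) :
    (⟨Units.mk0 μ⁻¹ (inv_ne_zero hμ), 0, 0, 0⟩ : VariableChange ℚ) • E = E' := by
  have ha₄ := WeierstrassCurve.Isogeny.a₄_eq_of_isShort E h₁ h₂ h₃
  have ha₆ := WeierstrassCurve.Isogeny.a₆_eq_of_isShort E h₁ h₂ h₃
  have ha₄' := WeierstrassCurve.Isogeny.a₄_eq_of_isShort E' h₁' h₂' h₃'
  have ha₆' := WeierstrassCurve.Isogeny.a₆_eq_of_isShort E' h₁' h₂' h₃'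
  have hu : ((Units.mk0 μ⁻¹ (inv_ne_zero hμ))⁻¹ : ℚˣ) = (μ : ℚ) := by simp
  ext
  · simp [variableChange_a₁, h₁, h₁']
  · simp [variableChange_a₂, h₁, h₂, h₂']
  · simp [variableChange_a₃, h₁, h₃, h₃']
  · simp only [variableChange_a₄, h₁, h₂, h₃, hu, mul_zero, sub_zero, add_zero]
    rw [ha₄', hc₄, ha₄]
    ring
  · simp only [variableChange_a₆, h₁, h₂, h₃, hu, mul_zero, sub_zero, add_zero, zero_mul]
    rw [ha₆', hc₆, ha₆]
    ring

/-- **I25 `VariableChangeOfRationalHomothety`** (stmt-BirchSwinnertonDyer-22887), by name: two elliptic curves over `ℚ`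
whose Néron-type period lattices are homothetic by a non-zero RATIONAL scalar differ by an admissible change of variables
over `ℚ` (`g₂, g₃` are lattice invariants ⇒ `c₄(A) = μ⁴c₄(T)`, `c₆(A) = μ⁶c₆(T)` ⇒ the short models are rescalings).
Proof = planner bsd-idea-3 g8's `ideas/l25/I25_byname.lean`, re-checked against the tree.
[cite: SilvermanAEC2009, III.1 and Prop. III.3.1(b)] -/
theorem variableChangeOfRationalHomothety_proof : VariableChangeOfRationalHomothety := by
  unfold VariableChangeOfRationalHomothety
  intro T A _ _ LT LA hT hA μ hμ hiff
  have hμC : (μ : ℂ) ≠ 0 := by exact_mod_cast hμ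
  -- `Λ_A = μ⁻¹ Λ_T`
  have hLL : (LT.mulLeft ((μ : ℂ)⁻¹) (inv_ne_zero hμC)).lattice = LA.lattice := by
    ext z
    rw [PeriodPair.mem_mulLeft_lattice, inv_inv]
    exact (hiff z).symm
  -- `c₄(A) = μ⁴ c₄(T)`, `c₆(A) = μ⁶ c₆(T)` in `ℚ`
  have hc₄ : A.c₄ = μ ^ 4 * T.c₄ := by
    have h := PeriodPair.g₂_eq_of_lattice_eq hLL
    rw [PeriodPair.g₂_mulLeft, hT.1, hA.1] at h
    simp only [WeierstrassCurve.baseChange, WeierstrassCurve.map_c₄, inv_pow, inv_inv] at h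
    apply (algebraMap ℚ ℂ).injective
    rw [map_mul, map_pow, eq_ratCast (algebraMap ℚ ℂ) μ]
    -- h : μ^4 * (c₄(T)/12) = c₄(A)/12
    linear_combination 12 * h.symm
  have hc₆ : A.c₆ = μ ^ 6 * T.c₆ := by
    have h := PeriodPair.g₃_eq_of_lattice_eq hLL
    rw [PeriodPair.g₃_mulLeft, hT.2, hA.2] at h
    simp only [WeierstrassCurve.baseChange, WeierstrassCurve.map_c₆, inv_pow, inv_inv] at h
    apply (algebraMap ℚ ℂ).injective
    rw [map_mul, map_pow, eq_ratCast (algebraMap ℚ ℂ) μ]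
    linear_combination 216 * h.symm
  -- short models (u = 1 changes keep c₄, c₆)
  haveI : Invertible (2 : ℚ) := invertibleOfNonzero two_ne_zero
  haveI : Invertible (3 : ℚ) := invertibleOfNonzero three_ne_zero
  set C : VariableChange ℚ := ⟨1, -T.b₂ / 12, -T.a₁ / 2, T.a₁ * T.b₂ / 24 - T.a₃ / 2⟩ with hC
  set C' : VariableChange ℚ := ⟨1, -A.b₂ / 12, -A.a₁ / 2, A.a₁ * A.b₂ / 24 - A.a₃ / 2⟩ with hC'
  obtain ⟨h₁, h₂, h₃⟩ := WeierstrassCurve.Isogeny.shortChange_a₁_a₂_a₃ T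
  obtain ⟨h₁', h₂', h₃'⟩ := WeierstrassCurve.Isogeny.shortChange_a₁_a₂_a₃ A
  have hc₄s : (C' • A).c₄ = μ ^ 4 * (C • T).c₄ := by
    rw [variableChange_c₄, variableChange_c₄, hC, hC']
    simpa using hc₄
  have hc₆s : (C' • A).c₆ = μ ^ 6 * (C • T).c₆ := by
    rw [variableChange_c₆, variableChange_c₆, hC, hC']
    simpa using hc₆
  have hD := smul_eq_of_isShort_of_c₄_c₆ (C • T) (C' • A) h₁ h₂ h₃ h₁' h₂' h₃' μ hμ hc₄s hc₆s
  refine ⟨C'⁻¹ * ⟨Units.mk0 μ⁻¹ (inv_ne_zero hμ), 0, 0, 0⟩ * C, ?_⟩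
  rw [mul_smul, mul_smul, hD, inv_smul_smul]

end Summit.BirchSwinnertonDyer.BirchSwinnertonDyer.Theorems.TameQuarticManinParity

end
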